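import Mathlib
import Summits.Ventures.PercRepro2.Defs
import Summits.Ventures.PercRepro2.Independence
import Summits.Ventures.PercRepro2.Harris
import Summits.Ventures.PercRepro2.Graph
import Summits.Ventures.PercRepro2.Exploration
import Summits.Ventures.PercRepro2.Events
import Summits.Ventures.PercRepro2.FourFunctions
import Summits.Ventures.PercRepro2.Induced
import Summits.Ventures.PercRepro2.Frontier
import Summits.Ventures.PercRepro2.ObsIndependence
import Summits.Ventures.PercRepro2.BHK
import Summits.Ventures.PercRepro2.BHKEvents
import Summits.Ventures.PercRepro2.CaseOneRegime

/-!
# The monotone part of PC1 is a theorem; the residual is the non-monotone part (blind cell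
PercRepro2, p1 g13; lead g23 tri/README 22:33Z «with F₁ = F₁⁺ − F₁⁻ … the slack of the monotone
part pays»)

`CaseOneRegime.lean` proves `PC1` when every host `W ∋ a₃` has `π′_W(o) ≤ γ`. Here the case-1
functional is split at its sign, `F = F⁺ − F⁻` with
`F⁺(W) = 1[a₃ ∈ W] · max (c₀ − c₁ π′_W(o)) 0` (**`caseOnePos`**) and
`F⁻(W) = 1[a₃ ∈ W] · max (c₁ π′_W(o) − c₀) 0` (**`caseOneNeg`**): `F⁺` is monotone and nonnegative
WITHOUT any hypothesis on the hosts (**`caseOnePos_monotone`**, **`caseOnePos_nonneg`**), so the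
cleared covariance `covExpr F := P(Q) E[σ_b F(C₁) 1_Q] − E[σ_b 1_Q] E[F(C₁) 1_Q]` of ANY nonnegative
monotone cluster functional is `≥ 0` (**`covExpr_nonneg_of_monotone`**: BHK 1.3 + the functional
BHK 1.4 `bhk_cross_cluster_fun`), in particular

  **`covExpr_caseOnePos_nonneg`: `Cov_μ(σ_b, F₁⁺(C₁)) ≥ 0` — the monotone part of PC1 is a THEOREM**,

and `pcOneExpr = covExpr F⁺ − covExpr F⁻` (**`pcOneExpr_eq_pos_sub_neg`**). Hence
**`pc1_iff_residual`**: `PC1 ⟺ covExpr F₁⁻ ≤ covExpr F₁⁺` (**`PC1Residual`**, the open content: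
the lead's census has `Cov_μ(σ_b, F₁⁻) > 0` on 2,451 / 5,074 non-monotone instances at n = 5, e.g.
`K₅` minus an edge, where the monotone part pays), and the regime theorem in the lead's exact
almost-sure form **`pc1_of_hosts_le_ae`**: `PC1` whenever every host `C₁(ω) ∋ a₃` of a configuration
`ω ∈ Q` of positive weight has `D · π′_{C₁(ω)}(o) ≤ D_o` (then `F₁⁻` vanishes on the support).
Definitions and kernel theorems only; no claim about `PC1Residual`. -/

namespace Summit.Ventures.PercRepro2

namespace CaseOne
section General
variable {V : Type*} {E : Type*} [Fintype E] [DecidableEq E] [Fintype V] [DecidableEq V]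
  {R : Type*} [CommRing R] [LinearOrder R] [IsStrictOrderedRing R]

omit [Fintype V] [DecidableEq V] [LinearOrder R] [IsStrictOrderedRing R] in
/-- **The cleared covariance of `σ_b` with a cluster functional of `C₁`**:
`P(Q) · E[σ_b F(C₁) 1_Q] − E[σ_b 1_Q] · E[F(C₁) 1_Q]` (`= P(Q)² · Cov_μ(σ_b, F(C₁))`). -/
noncomputable def covExpr (p : E → R) (ends : E → Sym2 V) (a₁ a₂ b : V) (F : Set V → R) : R :=
  prob p (connEvent ends a₁ a₂)ᶜ *
      expect p (fun ω => sigmaB ends a₁ a₂ b ω * F (cluster ends ω a₁) *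
        ((connEvent ends a₁ a₂)ᶜ).indicator 1 ω) -
    expect p (fun ω => sigmaB ends a₁ a₂ b ω * ((connEvent ends a₁ a₂)ᶜ).indicator 1 ω) *
      expect p (fun ω => F (cluster ends ω a₁) * ((connEvent ends a₁ a₂)ᶜ).indicator 1 ω)

omit [Fintype V] [DecidableEq V] [LinearOrder R] [IsStrictOrderedRing R] in
/-- `pcOneExpr` is `covExpr` of the case-1 functional. -/
lemma pcOneExpr_eq_covExpr (p : E → R) (ends : E → Sym2 V) (o a₁ a₂ a₃ b : V) (c₀ c₁ : R) :
    pcOneExpr p ends o a₁ a₂ a₃ b c₀ c₁ =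
      covExpr p ends a₁ a₂ b (caseOneFun p ends o a₂ a₃ c₀ c₁) := rfl

omit [Fintype V] [DecidableEq V] [LinearOrder R] [IsStrictOrderedRing R] in
/-- `covExpr` is linear: the difference of two functionals. -/
lemma covExpr_sub (p : E → R) (ends : E → Sym2 V) (a₁ a₂ b : V) (F G : Set V → R) :
    covExpr p ends a₁ a₂ b (fun W => F W - G W) =
      covExpr p ends a₁ a₂ b F - covExpr p ends a₁ a₂ b G := by
  unfold covExpr
  have e1 : expect p (fun ω => sigmaB ends a₁ a₂ b ω * (F (cluster ends ω a₁) - G (cluster ends ω a₁)) *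
      ((connEvent ends a₁ a₂)ᶜ).indicator 1 ω) =
      expect p (fun ω => sigmaB ends a₁ a₂ b ω * F (cluster ends ω a₁) *
          ((connEvent ends a₁ a₂)ᶜ).indicator 1 ω) -
        expect p (fun ω => sigmaB ends a₁ a₂ b ω * G (cluster ends ω a₁) *
          ((connEvent ends a₁ a₂)ᶜ).indicator 1 ω) := by
    rw [← expect_sub]
    congr 1
    funext ω
    simp only [Pi.sub_apply]
    ring
  have e2 : expect p (fun ω => (F (cluster ends ω a₁) - G (cluster ends ω a₁)) *
      ((connEvent ends a₁ a₂)ᶜ).indicator 1 ω) =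
      expect p (fun ω => F (cluster ends ω a₁) * ((connEvent ends a₁ a₂)ᶜ).indicator 1 ω) -
        expect p (fun ω => G (cluster ends ω a₁) * ((connEvent ends a₁ a₂)ᶜ).indicator 1 ω) := by
    rw [← expect_sub]
    congr 1
    funext ω
    simp only [Pi.sub_apply]
    ring
  rw [e1, e2]
  ring

omit [Fintype V] [DecidableEq V] in
/-- `{S ∋ v}` is an up-set of vertex sets. -/
private lemma isUpperSet_mem' (v : V) : IsUpperSet {S : Set V | v ∈ S} :=
  fun _ _ h hv => h hv

omit [DecidableEq V] in
/-- **The cleared covariance of `σ_b` with any nonnegative monotone cluster functional is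
nonnegative**: the `b ∈ C₁` half by BHK 1.3 (`bhk_same_cluster`), the `b ∈ C₂` half by the
functional BHK 1.4 (`bhk_cross_cluster_fun`). -/
theorem covExpr_nonneg_of_monotone (p : E → R) (hp : IsProbVec p) (ends : E → Sym2 V)
    (a₁ a₂ b : V) {F : Set V → R} (hF : Monotone F) (hF0 : ∀ S, 0 ≤ F S) :
    0 ≤ covExpr p ends a₁ a₂ b F := by
  classical
  have hIb_mono : Monotone (({S : Set V | b ∈ S}).indicator (1 : Set V → R)) :=
    monotone_indicator_one_of_isUpperSet (isUpperSet_mem' (V := V) b)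
  have hIb0 : ∀ S, 0 ≤ ({S : Set V | b ∈ S}).indicator (1 : Set V → R) S :=
    fun _ => Set.indicator_apply_nonneg fun _ => zero_le_one
  have same := bhk_same_cluster p hp ends a₁ a₂ hIb_mono hF hIb0 hF0
  have cross := bhk_cross_cluster_fun p hp ends a₁ a₂ hF hF0 (isUpperSet_mem' (V := V) b)
  have eP : prob p (clusterInEvent ends a₂ {S : Set V | b ∈ S} ∩ (connEvent ends a₁ a₂)ᶜ) =
      expect p (fun ω => ({S : Set V | b ∈ S}).indicator (1 : Set V → R) (cluster ends ω a₂) *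
        ((connEvent ends a₁ a₂)ᶜ).indicator 1 ω) := by
    rw [prob_eq_expect_indicator]
    congr 1
    funext ω
    by_cases h1 : b ∈ cluster ends ω a₂
    · by_cases h2 : ω ∈ (connEvent ends a₁ a₂)ᶜ
      · rw [Set.indicator_of_mem (show ω ∈ clusterInEvent ends a₂ {S : Set V | b ∈ S} ∩
            (connEvent ends a₁ a₂)ᶜ from ⟨h1, h2⟩),
          Set.indicator_of_mem (show cluster ends ω a₂ ∈ {S : Set V | b ∈ S} from h1),
          Set.indicator_of_mem h2]
        simp
      · rw [Set.indicator_of_notMem (show ω ∉ clusterInEvent ends a₂ {S : Set V | b ∈ S} ∩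
            (connEvent ends a₁ a₂)ᶜ from fun h => h2 h.2), Set.indicator_of_notMem h2]
        simp
    · rw [Set.indicator_of_notMem (show ω ∉ clusterInEvent ends a₂ {S : Set V | b ∈ S} ∩
          (connEvent ends a₁ a₂)ᶜ from fun h => h1 h.1),
        Set.indicator_of_notMem (show cluster ends ω a₂ ∉ {S : Set V | b ∈ S} from h1)]
      simp
  rw [eP] at cross
  unfold covExpr
  have e1 : expect p (fun ω => sigmaB ends a₁ a₂ b ω * F (cluster ends ω a₁) *
      ((connEvent ends a₁ a₂)ᶜ).indicator 1 ω) =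
      expect p (fun ω => ({S : Set V | b ∈ S}).indicator (1 : Set V → R) (cluster ends ω a₁) *
          F (cluster ends ω a₁) * ((connEvent ends a₁ a₂)ᶜ).indicator 1 ω) -
        expect p (fun ω => F (cluster ends ω a₁) *
          ({S : Set V | b ∈ S}).indicator (1 : Set V → R) (cluster ends ω a₂) *
          ((connEvent ends a₁ a₂)ᶜ).indicator 1 ω) := by
    rw [← expect_sub]
    congr 1
    funext ω
    simp only [Pi.sub_apply, sigmaB]
    ring
  have e2 : expect p (fun ω => sigmaB ends a₁ a₂ b ω * ((connEvent ends a₁ a₂)ᶜ).indicator 1 ω) =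
      expect p (fun ω => ({S : Set V | b ∈ S}).indicator (1 : Set V → R) (cluster ends ω a₁) *
          ((connEvent ends a₁ a₂)ᶜ).indicator 1 ω) -
        expect p (fun ω => ({S : Set V | b ∈ S}).indicator (1 : Set V → R) (cluster ends ω a₂) *
          ((connEvent ends a₁ a₂)ᶜ).indicator 1 ω) := by
    rw [← expect_sub]
    congr 1
    funext ω
    simp only [Pi.sub_apply, sigmaB]
    ring
  rw [e1, e2]
  nlinarith [same, cross]

end General
/-! ## The sign split of the case-1 functional -/

section Split
variable {V : Type*} {E : Type*} [Fintype E] [DecidableEq E] [Fintype V] [DecidableEq V]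
  {R : Type*} [CommRing R] [LinearOrder R] [IsStrictOrderedRing R]

/-- **The monotone part** `F⁺(W) = 1[a₃ ∈ W] · max (c₀ − c₁ π′_W(o)) 0` of the case-1 functional. -/
noncomputable def caseOnePos (p : E → R) (ends : E → Sym2 V) (o a₂ a₃ : V) (c₀ c₁ : R)
    (W : Set V) : R :=
  ({W' : Set V | a₃ ∈ W'}).indicator 1 W * max (c₀ - c₁ * delClusterProb p ends a₂ {S | o ∈ S} W) 0

/-- **The non-monotone part** `F⁻(W) = 1[a₃ ∈ W] · max (c₁ π′_W(o) − c₀) 0`: the upward jump of the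
case-1 functional at the hosts whose odds exceed the threshold. -/
noncomputable def caseOneNeg (p : E → R) (ends : E → Sym2 V) (o a₂ a₃ : V) (c₀ c₁ : R)
    (W : Set V) : R :=
  ({W' : Set V | a₃ ∈ W'}).indicator 1 W * max (c₁ * delClusterProb p ends a₂ {S | o ∈ S} W - c₀) 0

omit [Fintype V] [DecidableEq V] in
/-- `F = F⁺ − F⁻`. -/
lemma caseOneFun_eq_pos_sub_neg (p : E → R) (ends : E → Sym2 V) (o a₂ a₃ : V) (c₀ c₁ : R)
    (W : Set V) :
    caseOneFun p ends o a₂ a₃ c₀ c₁ W =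
      caseOnePos p ends o a₂ a₃ c₀ c₁ W - caseOneNeg p ends o a₂ a₃ c₀ c₁ W := by
  unfold caseOneFun caseOnePos caseOneNeg
  have key : ∀ x : R, max x 0 - max (-x) 0 = x := fun x => by
    rcases le_total x 0 with h | h
    · rw [max_eq_right h, max_eq_left (show 0 ≤ -x by linarith)]
      ring
    · rw [max_eq_left h, max_eq_right (show -x ≤ 0 by linarith)]
      ring
  rw [← mul_sub, show c₁ * delClusterProb p ends a₂ {S | o ∈ S} W - c₀ =
    -(c₀ - c₁ * delClusterProb p ends a₂ {S | o ∈ S} W) by ring, key]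

omit [Fintype V] [DecidableEq V] in
/-- **`F⁺` is monotone** (no hypothesis on the hosts; `c₁ ≥ 0`). -/
theorem caseOnePos_monotone (p : E → R) (hp : IsProbVec p) (ends : E → Sym2 V) (o a₂ a₃ : V)
    {c₀ c₁ : R} (hc₁ : 0 ≤ c₁) : Monotone (caseOnePos p ends o a₂ a₃ c₀ c₁) := by
  intro W W' hWW'
  unfold caseOnePos
  have hanti := delClusterProb_anti p hp ends a₂ (isUpperSet_mem' (V := V) o) hWW'
  have hle : c₀ - c₁ * delClusterProb p ends a₂ {S | o ∈ S} W ≤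
      c₀ - c₁ * delClusterProb p ends a₂ {S | o ∈ S} W' := by
    have := mul_le_mul_of_nonneg_left hanti hc₁
    linarith
  by_cases hW : a₃ ∈ W
  · have hW' : a₃ ∈ W' := hWW' hW
    rw [Set.indicator_of_mem (show W ∈ {W' : Set V | a₃ ∈ W'} from hW),
      Set.indicator_of_mem (show W' ∈ {W' : Set V | a₃ ∈ W'} from hW')]
    simp only [Pi.one_apply, one_mul]
    exact max_le_max hle le_rfl
  · rw [Set.indicator_of_notMem (show W ∉ {W' : Set V | a₃ ∈ W'} from hW)]
    simp only [zero_mul]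
    exact mul_nonneg (Set.indicator_apply_nonneg fun _ => zero_le_one) (le_max_right _ _)

omit [Fintype V] [DecidableEq V] in
/-- **`F⁺ ≥ 0`.** -/
theorem caseOnePos_nonneg (p : E → R) (ends : E → Sym2 V) (o a₂ a₃ : V) (c₀ c₁ : R) (W : Set V) :
    0 ≤ caseOnePos p ends o a₂ a₃ c₀ c₁ W :=
  mul_nonneg (Set.indicator_apply_nonneg fun _ => zero_le_one) (le_max_right _ _)

omit [DecidableEq V] in
/-- **The monotone part of PC1 is a theorem**: `Cov_μ(σ_b, F⁺(C₁)) ≥ 0` for every threshold pair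
with `c₁ ≥ 0`. -/
theorem covExpr_caseOnePos_nonneg (p : E → R) (hp : IsProbVec p) (ends : E → Sym2 V)
    (o a₁ a₂ a₃ b : V) {c₀ c₁ : R} (hc₁ : 0 ≤ c₁) :
    0 ≤ covExpr p ends a₁ a₂ b (caseOnePos p ends o a₂ a₃ c₀ c₁) :=
  covExpr_nonneg_of_monotone p hp ends a₁ a₂ b (caseOnePos_monotone p hp ends o a₂ a₃ hc₁)
    (caseOnePos_nonneg p ends o a₂ a₃ c₀ c₁)

omit [Fintype V] [DecidableEq V] in
/-- **`pcOneExpr = covExpr F⁺ − covExpr F⁻`.** -/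
theorem pcOneExpr_eq_pos_sub_neg (p : E → R) (ends : E → Sym2 V) (o a₁ a₂ a₃ b : V) (c₀ c₁ : R) :
    pcOneExpr p ends o a₁ a₂ a₃ b c₀ c₁ =
      covExpr p ends a₁ a₂ b (caseOnePos p ends o a₂ a₃ c₀ c₁) -
        covExpr p ends a₁ a₂ b (caseOneNeg p ends o a₂ a₃ c₀ c₁) := by
  rw [pcOneExpr_eq_covExpr, ← covExpr_sub]
  congr 1
  funext W
  exact caseOneFun_eq_pos_sub_neg p ends o a₂ a₃ c₀ c₁ W

/-- **The residual of PC1**: the cleared covariance of `σ_b` with the non-monotone part `F₁⁻` is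
at most that with the monotone part `F₁⁺` (threshold pair `(D_o, D)`). A definition only — the
open content of `PC1` (`pc1_iff_residual`). -/
def PC1Residual (p : E → R) (ends : E → Sym2 V) (o a₁ a₂ a₃ b : V) : Prop :=
  covExpr p ends a₁ a₂ b
      (caseOneNeg p ends o a₂ a₃ (Dpdo p ends o a₁ a₂ a₃) (Dpd p ends a₁ a₂ a₃)) ≤
    covExpr p ends a₁ a₂ b
      (caseOnePos p ends o a₂ a₃ (Dpdo p ends o a₁ a₂ a₃) (Dpd p ends a₁ a₂ a₃))

omit [Fintype V] [DecidableEq V] in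
/-- **`PC1 ⟺ PC1Residual`.** -/
theorem pc1_iff_residual (p : E → R) (ends : E → Sym2 V) (o a₁ a₂ a₃ b : V) :
    PC1 p ends o a₁ a₂ a₃ b ↔ PC1Residual p ends o a₁ a₂ a₃ b := by
  unfold PC1 PC1Residual
  rw [pcOneExpr_eq_pos_sub_neg]
  constructor
  · intro h; linarith
  · intro h; linarith

omit [Fintype V] [DecidableEq V] in
/-- **`F⁻` vanishes on the support under the almost-sure host bound**: if every configuration of
nonzero weight in `Q` whose host `C₁ ∋ a₃` has `c₁ π′ ≤ c₀`, then `covExpr F⁻ = 0`. -/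
theorem covExpr_caseOneNeg_eq_zero (p : E → R) (ends : E → Sym2 V) (o a₁ a₂ a₃ b : V)
    {c₀ c₁ : R}
    (h : ∀ ω : Config E, weight p ω ≠ 0 → ω ∈ (connEvent ends a₁ a₂)ᶜ →
      a₃ ∈ cluster ends ω a₁ →
        c₁ * delClusterProb p ends a₂ {S | o ∈ S} (cluster ends ω a₁) ≤ c₀) :
    covExpr p ends a₁ a₂ b (caseOneNeg p ends o a₂ a₃ c₀ c₁) = 0 := by
  have hz : ∀ ω : Config E, weight p ω * (caseOneNeg p ends o a₂ a₃ c₀ c₁ (cluster ends ω a₁) *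
      ((connEvent ends a₁ a₂)ᶜ).indicator 1 ω) = 0 := by
    intro ω
    by_cases hw : weight p ω = 0
    · rw [hw, zero_mul]
    by_cases hQ : ω ∈ (connEvent ends a₁ a₂)ᶜ
    · by_cases h3 : a₃ ∈ cluster ends ω a₁
      · have hb := h ω hw hQ h3
        unfold caseOneNeg
        rw [max_eq_right (show c₁ * delClusterProb p ends a₂ {S | o ∈ S} (cluster ends ω a₁) - c₀ ≤ 0
          by linarith)]
        simp
      · unfold caseOneNeg
        rw [Set.indicator_of_notMem (show cluster ends ω a₁ ∉ {W' : Set V | a₃ ∈ W'} from h3)]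
        simp
    · rw [Set.indicator_of_notMem hQ]
      simp
  have e1 : expect p (fun ω => sigmaB ends a₁ a₂ b ω * caseOneNeg p ends o a₂ a₃ c₀ c₁ (cluster ends ω a₁) *
      ((connEvent ends a₁ a₂)ᶜ).indicator 1 ω) = 0 := by
    unfold expect
    refine Finset.sum_eq_zero fun ω _ => ?_
    have := hz ω
    calc weight p ω * (sigmaB ends a₁ a₂ b ω * caseOneNeg p ends o a₂ a₃ c₀ c₁ (cluster ends ω a₁) *
          ((connEvent ends a₁ a₂)ᶜ).indicator 1 ω)
        = sigmaB ends a₁ a₂ b ω * (weight p ω * (caseOneNeg p ends o a₂ a₃ c₀ c₁ (cluster ends ω a₁) *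
          ((connEvent ends a₁ a₂)ᶜ).indicator 1 ω)) := by ring
      _ = 0 := by rw [this, mul_zero]
  have e2 : expect p (fun ω => caseOneNeg p ends o a₂ a₃ c₀ c₁ (cluster ends ω a₁) *
      ((connEvent ends a₁ a₂)ᶜ).indicator 1 ω) = 0 := by
    unfold expect
    exact Finset.sum_eq_zero fun ω _ => hz ω
  unfold covExpr
  rw [e1, e2]
  ring

omit [DecidableEq V] in
/-- **`PC1` in the monotone-host regime, almost-sure form** (the lead's «every host `R ∋ a₃` of
positive `μ`-mass»): if every configuration `ω ∈ Q` of nonzero weight with `a₃ ∈ C₁(ω)` has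
`D · π′_{C₁(ω)}(o) ≤ D_o`, then `PC1`. -/
theorem pc1_of_hosts_le_ae (p : E → R) (hp : IsProbVec p) (ends : E → Sym2 V) (o a₁ a₂ a₃ b : V)
    (h : ∀ ω : Config E, weight p ω ≠ 0 → ω ∈ (connEvent ends a₁ a₂)ᶜ →
      a₃ ∈ cluster ends ω a₁ →
        Dpd p ends a₁ a₂ a₃ * delClusterProb p ends a₂ {S | o ∈ S} (cluster ends ω a₁) ≤
          Dpdo p ends o a₁ a₂ a₃) :
    PC1 p ends o a₁ a₂ a₃ b := by
  rw [pc1_iff_residual]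
  unfold PC1Residual
  rw [covExpr_caseOneNeg_eq_zero p ends o a₁ a₂ a₃ b h]
  exact covExpr_caseOnePos_nonneg p hp ends o a₁ a₂ a₃ b (prob_nonneg hp _)

end Split
/-! ## The threshold dependence: `PC1` is a comparison of two covariances -/

section Threshold
variable {V : Type*} {E : Type*} [Fintype E] [DecidableEq E] [Fintype V] [DecidableEq V]
  {R : Type*} [CommRing R] [LinearOrder R] [IsStrictOrderedRing R]

omit [Fintype V] [DecidableEq V] [LinearOrder R] [IsStrictOrderedRing R] in
/-- `covExpr` is linear: scalar multiples. -/
lemma covExpr_const_mul (p : E → R) (ends : E → Sym2 V) (a₁ a₂ b : V) (c : R) (F : Set V → R) :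
    covExpr p ends a₁ a₂ b (fun W => c * F W) = c * covExpr p ends a₁ a₂ b F := by
  unfold covExpr
  have e1 : expect p (fun ω => sigmaB ends a₁ a₂ b ω * (c * F (cluster ends ω a₁)) *
      ((connEvent ends a₁ a₂)ᶜ).indicator 1 ω) =
      c * expect p (fun ω => sigmaB ends a₁ a₂ b ω * F (cluster ends ω a₁) *
        ((connEvent ends a₁ a₂)ᶜ).indicator 1 ω) := by
    rw [← expect_const_mul]
    congr 1
    funext ω
    ring
  have e2 : expect p (fun ω => c * F (cluster ends ω a₁) * ((connEvent ends a₁ a₂)ᶜ).indicator 1 ω) =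
      c * expect p (fun ω => F (cluster ends ω a₁) * ((connEvent ends a₁ a₂)ᶜ).indicator 1 ω) := by
    rw [← expect_const_mul]
    congr 1
    funext ω
    ring
  rw [e1, e2]
  ring

omit [Fintype V] [DecidableEq V] [LinearOrder R] [IsStrictOrderedRing R] in
/-- **`pcOneExpr` is affine in the threshold pair**:
`pcOneExpr c₀ c₁ = c₀ · covExpr 1[a₃ ∈ ·] − c₁ · covExpr (1[a₃ ∈ ·] π′(o))`. -/
theorem pcOneExpr_eq_affine (p : E → R) (ends : E → Sym2 V) (o a₁ a₂ a₃ b : V) (c₀ c₁ : R) :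
    pcOneExpr p ends o a₁ a₂ a₃ b c₀ c₁ =
      c₀ * covExpr p ends a₁ a₂ b (({W' : Set V | a₃ ∈ W'}).indicator 1) -
        c₁ * covExpr p ends a₁ a₂ b (fun W => ({W' : Set V | a₃ ∈ W'}).indicator 1 W *
          delClusterProb p ends a₂ {S | o ∈ S} W) := by
  rw [pcOneExpr_eq_covExpr, ← covExpr_const_mul, ← covExpr_const_mul, ← covExpr_sub]
  congr 1
  funext W
  unfold caseOneFun
  ring

omit [DecidableEq V] in
/-- **`Cov_μ(σ_b, 1[a₃ ∈ C₁]) ≥ 0`** (the lead's `β̄₁ − β̄ ≥ 0`: BHK 1.2 + 1.4). -/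
theorem covExpr_indicator_nonneg (p : E → R) (hp : IsProbVec p) (ends : E → Sym2 V)
    (a₁ a₂ a₃ b : V) :
    0 ≤ covExpr p ends a₁ a₂ b (({W' : Set V | a₃ ∈ W'}).indicator 1) :=
  covExpr_nonneg_of_monotone p hp ends a₁ a₂ b
    (monotone_indicator_one_of_isUpperSet (isUpperSet_mem' (V := V) a₃))
    (fun _ => Set.indicator_apply_nonneg fun _ => zero_le_one)

omit [DecidableEq V] in
/-- **The per-case covariance is monotone in the threshold.** -/
theorem pcOneExpr_mono_threshold (p : E → R) (hp : IsProbVec p) (ends : E → Sym2 V)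
    (o a₁ a₂ a₃ b : V) {c₀ c₀' c₁ : R} (h : c₀ ≤ c₀') :
    pcOneExpr p ends o a₁ a₂ a₃ b c₀ c₁ ≤ pcOneExpr p ends o a₁ a₂ a₃ b c₀' c₁ := by
  rw [pcOneExpr_eq_affine, pcOneExpr_eq_affine]
  have := mul_le_mul_of_nonneg_right h (covExpr_indicator_nonneg p hp ends a₁ a₂ a₃ b)
  linarith

omit [Fintype V] [DecidableEq V] in
/-- **`PC1` as a comparison of two covariances**:
`PC1 ⟺ D · Cov_μ(σ_b, 1[a₃ ∈ C₁] π′_{C₁}(o)) ≤ D_o · Cov_μ(σ_b, 1[a₃ ∈ C₁])` (cleared by `P(Q)²`) —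
the host-revealed form of the lead's `(J1₁)`. -/
theorem pc1_iff_threshold (p : E → R) (ends : E → Sym2 V) (o a₁ a₂ a₃ b : V) :
    PC1 p ends o a₁ a₂ a₃ b ↔
      Dpd p ends a₁ a₂ a₃ * covExpr p ends a₁ a₂ b (fun W => ({W' : Set V | a₃ ∈ W'}).indicator 1 W *
          delClusterProb p ends a₂ {S | o ∈ S} W) ≤
        Dpdo p ends o a₁ a₂ a₃ * covExpr p ends a₁ a₂ b (({W' : Set V | a₃ ∈ W'}).indicator 1) := by
  unfold PC1
  rw [pcOneExpr_eq_affine]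
  constructor
  · intro h; linarith
  · intro h; linarith

end Threshold

end CaseOne

end Summit.Ventures.PercRepro2
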